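import Mathlib.FieldTheory.Galois.Basic
import Mathlib.FieldTheory.Galois.Infinite
import Mathlib.FieldTheory.KrullTopology
import Mathlib.FieldTheory.IntermediateField.Adjoin.Basic
import Mathlib.FieldTheory.Minpoly.Field
import Mathlib.GroupTheory.Index
import Mathlib.GroupTheory.IndexNormal
import Mathlib.Topology.Algebra.OpenSubgroup
import HarnessLib

/-!
# [EtTh] §1 setting: Galois plumbing for the fields `K ⊆ K_N`, `K̈ = K(q_X^{1/2})` inside `K̄`

Mochizuki, *The étale theta function and its Frobenioid-theoretic manifestations*, Publ. RIMS **45**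
(2009), §1, PRIMS PDF pp. 13–14, 17 (printed 239–240, 243): "`K_N := K(ζ_N, q_X^{1/N}) ⊆ K̄`",
"`Gal(K_N/K)`", "`G_{K_N}`" (p. 13), "`J_N` … a finite Galois extension of `K_N`" (p. 14),
"`K̈ := K̈₁ = J̈₁ = K₂`", "`K̈_N := K_{2N}`" (p. 17) [cite: MochizukiEtTh2009, §1 p.13].

Cell abc-iut, layer L2, unit W2-L2-03 re-pointed (L2 ruling R-7 (c)): the [EtTh] §1 root
`EtaleTheta/Setting.lean` (seat abc-iut-L2-t1, v3) is typed over the tree interface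
`SemiGraphs.TemperedCurve p`, whose base field is a finite subextension
`K : IntermediateField ℚ_[p] (AlgebraicClosure ℚ_[p])` with `G_K := K.fixingSubgroup ≤ G_{ℚ_p}`. The
finite extensions `K_N`, `K̈`, `J_N`, `J̈_N` of `K` inside `K̄` that §1 fixes are then intermediate
fields `L ≥ K` of `K̄/ℚ_p`, and their absolute Galois groups are the subgroups
`L.fixingSubgroup ≤ K.fixingSubgroup`. This Mathlib-only file supplies the RELATIVE (to `G_K`)
statements the root needs to turn the v2 axioms `GKN_normal`, `isOpen_GKN`, `relindex …`,
`GKdd …` into definitions and theorems. Everything is stated for an arbitrary tower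
`k ⊆ K ⊆ L ⊆ E` of fields (`K L : IntermediateField k E`); the root instantiates `k := ℚ_[p]`,
`E := AlgebraicClosure ℚ_[p]`.

What Mathlib already provides (use directly, not restated here): `IntermediateField.fixingSubgroup_le`
(`K ≤ L → L.fixingSubgroup ≤ K.fixingSubgroup`), `IntermediateField.fixingSubgroup_isOpen`,
`IntermediateField.fixingSubgroup_isClosed`, `InfiniteGalois.normal_iff_isGalois` and
`IntermediateField.finrank_eq_fixingSubgroup_index` (both ABSOLUTE, i.e. relative to `Gal(E/k)`),
`IntermediateField.fixingSubgroupEquiv : ↥K.fixingSubgroup ≃* Gal(E/K)`,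
`IntermediateField.extendScalars (h : K ≤ L) : IntermediateField K E`.

Contents (namespace `Literature.AnabelianGeometry.EtaleTheta.SettingGalois`):
* `subgroupOf_fixingSubgroup_eq_comap` — the dictionary: `G_L ≤ G_K` viewed inside `G_K` is the
  pull-back of `Gal(E/L') ≤ Gal(E/K)` (`L' = L` as an extension of `K`) along
  `fixingSubgroupEquiv`;
* `isOpen_subgroupOf_fixingSubgroup` — `G_L` is open in `G_K` (`L/k` finite);
* `normal_subgroupOf_fixingSubgroup_iff` — `G_L ⊴ G_K ↔ L/K` Galois (`E/k` Galois);
* `relIndex_fixingSubgroup_eq_finrank` — `[G_K : G_L] = [L : K]` (`E/k` Galois);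
* `mem_fixingSubgroup_restrictScalars_adjoin_iff` — `σ ∈ G_{K(S)} ↔ σ ∈ G_K ∧ σ` fixes `S`;
* `finrank_adjoin_simple_le_two_of_sq_mem`, `relIndex_fixingSubgroup_adjoin_le_two_of_sq_mem`,
  `normal_subgroupOf_fixingSubgroup_adjoin_of_sq_mem` — `K̈ = K(√q)`: `[K̈ : K] ≤ 2`, so
  `[G_K : G_K̈] ≤ 2` and `G_K̈ ⊴ G_K` (a subgroup of index `≤ 2` is normal).
Pure field/Galois theory; nothing specific to `p`-adic fields; no statement of [EtTh] is asserted.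
-/

noncomputable section

namespace Literature.AnabelianGeometry.EtaleTheta.SettingGalois

open IntermediateField Polynomial

variable {k E : Type*} [Field k] [Field E] [Algebra k E]

/-! ### The dictionary `G_L ≤ G_K` inside `G_K` versus `Gal(E/L) ≤ Gal(E/K)` -/

/-- For `K ≤ L` intermediate fields of `E/k`: the subgroup `G_L = L.fixingSubgroup` of
`G_K = K.fixingSubgroup` is the pull-back, along `G_K ≃* Gal(E/K)`
(`IntermediateField.fixingSubgroupEquiv`), of the fixing subgroup of `L` regarded as an intermediate
field of `E/K` (`extendScalars`). This is the bridge that turns Mathlib's ABSOLUTE infinite Galois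
theory over the base `K` into statements RELATIVE to `G_K ≤ Gal(E/k)` ([EtTh] p. 13: "`G_{K_N}`",
"`Gal(K_N/K)`" for `K_N ⊇ K` inside `K̄`). [cite: MochizukiEtTh2009, §1 p.13] -/
theorem subgroupOf_fixingSubgroup_eq_comap {K L : IntermediateField k E} (h : K ≤ L) :
    L.fixingSubgroup.subgroupOf K.fixingSubgroup =
      (extendScalars h).fixingSubgroup.comap (fixingSubgroupEquiv (K := K)).toMonoidHom := by
  ext σ
  simp only [Subgroup.mem_subgroupOf, IntermediateField.mem_fixingSubgroup_iff, Subgroup.mem_comap,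
    MulEquiv.coe_toMonoidHom, mem_extendScalars]
  rfl

/-- `G_L` is open in `G_K` when `L/k` is finite (`K ≤ L`): the subspace topology of
`G_K ≤ Gal(E/k)` (Krull topology); [EtTh] p. 13 uses `G_{K_N} ⊆ G_K` for the finite extension
`K_N/K`. [cite: MochizukiEtTh2009, §1 p.13] -/
theorem isOpen_subgroupOf_fixingSubgroup (K L : IntermediateField k E) [FiniteDimensional k L] :
    IsOpen ((L.fixingSubgroup.subgroupOf K.fixingSubgroup : Subgroup K.fixingSubgroup) :
      Set K.fixingSubgroup) :=
  Subgroup.subgroupOf_isOpen _ _ L.fixingSubgroup_isOpen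

/-- `G_L ⊴ G_K` if and only if `L/K` is Galois (`E/k` Galois, `K ≤ L ≤ E`): the relative form of
Mathlib's `InfiniteGalois.normal_iff_isGalois`, transported along `G_K ≃* Gal(E/K)`; [EtTh] p. 13
forms "`Gal(K_N/K)`" for the Galois extension `K_N = K(ζ_N, q_X^{1/N})` of `K`.
[cite: MochizukiEtTh2009, §1 p.13] -/
theorem normal_subgroupOf_fixingSubgroup_iff [IsGalois k E] {K L : IntermediateField k E}
    (h : K ≤ L) :
    (L.fixingSubgroup.subgroupOf K.fixingSubgroup).Normal ↔ IsGalois K (extendScalars h) := by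
  rw [← InfiniteGalois.normal_iff_isGalois (extendScalars h), subgroupOf_fixingSubgroup_eq_comap h]
  have hsurj : Function.Surjective (fixingSubgroupEquiv (K := K)).toMonoidHom :=
    (fixingSubgroupEquiv (K := K)).surjective
  constructor
  · intro hN
    have := Subgroup.Normal.map hN _ hsurj
    rwa [Subgroup.map_comap_eq_self_of_surjective hsurj] at this
  · intro hN
    exact Subgroup.Normal.comap hN _

/-- One direction of `normal_subgroupOf_fixingSubgroup_iff` as an implication from the Galois
property of `L/K`. [cite: MochizukiEtTh2009, §1 p.13] -/
theorem normal_subgroupOf_fixingSubgroup [IsGalois k E] {K L : IntermediateField k E} (h : K ≤ L)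
    [hL : IsGalois K (extendScalars h)] : (L.fixingSubgroup.subgroupOf K.fixingSubgroup).Normal :=
  (normal_subgroupOf_fixingSubgroup_iff h).mpr hL

/-- `[G_K : G_L] = [L : K]` for `K ≤ L ≤ E` with `E/k` Galois: the relative index of the fixing
subgroups is the degree of `L/K` (relative form of Mathlib's
`IntermediateField.finrank_eq_fixingSubgroup_index`); [EtTh] p. 13:
"`1 → (Δ^tp_Y)^ell ⊗ ℤ/Nℤ → Gal(Y_N/Y) → Gal(K_N/K) → 1`" uses `Gal(K_N/K) = G_K/G_{K_N}`.
An infinite-dimensional `L/K` gives `0 = 0` (both sides are then `0` by convention).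
[cite: MochizukiEtTh2009, §1 p.13] -/
theorem relIndex_fixingSubgroup_eq_finrank [IsGalois k E] {K L : IntermediateField k E} (h : K ≤ L) :
    L.fixingSubgroup.relIndex K.fixingSubgroup = Module.finrank K (extendScalars h) := by
  have hsurj : Function.Surjective (fixingSubgroupEquiv (K := K)).toMonoidHom :=
    (fixingSubgroupEquiv (K := K)).surjective
  rw [Subgroup.relIndex, subgroupOf_fixingSubgroup_eq_comap h]
  exact ((extendScalars h).fixingSubgroup.index_comap_of_surjective hsurj).trans
    (IntermediateField.finrank_eq_fixingSubgroup_index (extendScalars h)).symm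

/-! ### Adjoining elements to `K` inside `E`: `K(S)` and its Galois group -/

/-- Membership in `G_{K(S)}`: an automorphism `σ ∈ Gal(E/k)` fixes `K(S)` (the intermediate field
`K(S) = restrictScalars k (adjoin K S)` of `E/k`) iff it fixes `K` and every element of `S`;
[EtTh] pp. 13, 17: `K_N = K(ζ_N, q_X^{1/N})`, `K̈ = K(q_X^{1/2})`.
[cite: MochizukiEtTh2009, §1 p.13] -/
theorem mem_fixingSubgroup_restrictScalars_adjoin_iff (K : IntermediateField k E) (S : Set E)
    (σ : Gal(E/k)) :
    σ ∈ (restrictScalars k (adjoin K S)).fixingSubgroup ↔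
      σ ∈ K.fixingSubgroup ∧ ∀ s ∈ S, σ s = s := by
  simp only [IntermediateField.mem_fixingSubgroup_iff, mem_restrictScalars]
  constructor
  · intro hσ
    refine ⟨fun x hx => hσ x ?_, fun s hs => hσ s (subset_adjoin K S hs)⟩
    exact (adjoin K S).algebraMap_mem ⟨x, hx⟩
  · rintro ⟨hK, hS⟩ x hx
    refine adjoin_induction K (p := fun y _ => σ y = y) (fun y hy => hS y hy) ?_ ?_ ?_ ?_ hx
    · intro y
      exact hK y y.2
    · intro y z _ _ hy hz
      rw [map_add, hy, hz]
    · intro y _ hy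
      rw [map_inv₀, hy]
    · intro y z _ _ hy hz
      rw [map_mul, hy, hz]

/-- `K ≤ K(S)` inside `E/k`. [cite: MochizukiEtTh2009, §1 p.13] -/
theorem le_restrictScalars_adjoin (K : IntermediateField k E) (S : Set E) :
    K ≤ restrictScalars k (adjoin K S) :=
  fun x hx => (adjoin K S).algebraMap_mem ⟨x, hx⟩

/-- `K(S)` regarded as an extension of `K` is `adjoin K S`. [cite: MochizukiEtTh2009, §1 p.13] -/
theorem extendScalars_restrictScalars_adjoin (K : IntermediateField k E) (S : Set E) :
    extendScalars (le_restrictScalars_adjoin K S) = adjoin K S := rfl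

/-! ### `K̈ = K(q^{1/2})`: degree `≤ 2`, so `G_K̈` has index `≤ 2` in `G_K` and is normal -/

/-- If `s² ∈ K` then `s` is integral over `K` (root of the monic `X² − s²`). Private helper.
[folklore] -/
private theorem isIntegral_of_sq_mem (K : IntermediateField k E) {s : E} (hs : s ^ 2 ∈ K) :
    IsIntegral K s :=
  ⟨X ^ 2 - C (⟨s ^ 2, hs⟩ : K), monic_X_pow_sub_C _ (by norm_num), by
    simp [Polynomial.eval₂_eq_eval_map]⟩

/-- If `s² ∈ K` then `[K(s) : K] ≤ 2` (the minimal polynomial of `s` divides `X² − s²`);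
[EtTh] p. 17: "`K̈ := K̈₁ = J̈₁ = K₂`" `= K(ζ₂, q_X^{1/2}) = K(q_X^{1/2})`.
[cite: MochizukiEtTh2009, §1 p.17] -/
theorem finrank_adjoin_simple_le_two_of_sq_mem (K : IntermediateField k E) {s : E}
    (hs : s ^ 2 ∈ K) : Module.finrank K K⟮s⟯ ≤ 2 := by
  set a : K := ⟨s ^ 2, hs⟩ with ha
  have hroot : aeval s (X ^ 2 - C a : K[X]) = 0 := by
    simp [ha]
  have hne : (X ^ 2 - C a : K[X]) ≠ 0 := X_pow_sub_C_ne_zero (by norm_num) a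
  rw [adjoin.finrank (isIntegral_of_sq_mem K hs)]
  have hdeg := minpoly.degree_le_of_ne_zero K s hne hroot
  have h2 : (X ^ 2 - C a : K[X]).natDegree = 2 := natDegree_X_pow_sub_C
  calc (minpoly K s).natDegree ≤ (X ^ 2 - C a : K[X]).natDegree :=
        natDegree_le_natDegree hdeg
    _ = 2 := h2

/-- `[G_K : G_{K(s)}] ≤ 2` when `s² ∈ K` (`E/k` Galois): the absolute Galois group of
`K̈ = K(q_X^{1/2})` has index at most `2` in `G_K` ([EtTh] p. 17).
[cite: MochizukiEtTh2009, §1 p.17] -/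
theorem relIndex_fixingSubgroup_adjoin_le_two_of_sq_mem [IsGalois k E] (K : IntermediateField k E)
    {s : E} (hs : s ^ 2 ∈ K) :
    (restrictScalars k K⟮s⟯).fixingSubgroup.relIndex K.fixingSubgroup ≤ 2 := by
  rw [relIndex_fixingSubgroup_eq_finrank (le_restrictScalars_adjoin K {s}),
    extendScalars_restrictScalars_adjoin]
  exact finrank_adjoin_simple_le_two_of_sq_mem K hs

/-- `[G_K : G_{K(s)}]` is `1` or `2` when `s² ∈ K` (`E/k` Galois) — it is finite and nonzero
because `K(s)/K` is finite. [cite: MochizukiEtTh2009, §1 p.17] -/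
theorem relIndex_fixingSubgroup_adjoin_ne_zero_of_sq_mem [IsGalois k E] (K : IntermediateField k E)
    {s : E} (hs : s ^ 2 ∈ K) :
    (restrictScalars k K⟮s⟯).fixingSubgroup.relIndex K.fixingSubgroup ≠ 0 := by
  rw [relIndex_fixingSubgroup_eq_finrank (le_restrictScalars_adjoin K {s}),
    extendScalars_restrictScalars_adjoin]
  haveI : FiniteDimensional K K⟮s⟯ := adjoin.finiteDimensional (isIntegral_of_sq_mem K hs)
  exact Module.finrank_pos.ne'

/-- `G_{K(s)} ⊴ G_K` when `s² ∈ K` (`E/k` Galois): a subgroup of index `1` or `2` is normal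
(`Subgroup.normal_of_index_eq_two`); [EtTh] p. 17 forms `Gal(K̈/K)`-style quotients for
`K̈ = K(q_X^{1/2})`. [cite: MochizukiEtTh2009, §1 p.17] -/
theorem normal_subgroupOf_fixingSubgroup_adjoin_of_sq_mem [IsGalois k E] (K : IntermediateField k E)
    {s : E} (hs : s ^ 2 ∈ K) :
    ((restrictScalars k K⟮s⟯).fixingSubgroup.subgroupOf K.fixingSubgroup).Normal := by
  have hle := relIndex_fixingSubgroup_adjoin_le_two_of_sq_mem K hs
  have hne := relIndex_fixingSubgroup_adjoin_ne_zero_of_sq_mem K hs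
  rw [Subgroup.relIndex] at hle hne
  set H := (restrictScalars k K⟮s⟯).fixingSubgroup.subgroupOf K.fixingSubgroup
  rcases Nat.lt_or_ge H.index 2 with hlt | hge
  · have h1 : H.index = 1 := by omega
    rw [Subgroup.index_eq_one] at h1
    rw [h1]; infer_instance
  · exact Subgroup.normal_of_index_eq_two (le_antisymm hle hge)

end Literature.AnabelianGeometry.EtaleTheta.SettingGalois

end
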